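import Summits.ValiantsHypothesis.ValiantsHypothesis.Theses.UlrichPadded
import Summits.ValiantsHypothesis.ValiantsHypothesis.Theorems.UlrichPaddedPermHypersurfaceFactorial
import Summits.ValiantsHypothesis.ValiantsHypothesis.Theorems.UlrichPaddedRankOneTrivialisationAdjugateTwoByTwo
import Summits.ValiantsHypothesis.ValiantsHypothesis.Theorems.UlrichPaddedRankOneTrivialisationUfdOuterProduct
import Summits.ValiantsHypothesis.ValiantsHypothesis.Theorems.UlrichPaddedRankOneTrivialisationDegreeBudget
import Literature.Computability.AlgebraicComplexity.PermanentIrreducible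
import Literature.RingTheory.MvPolynomial.KaltofenBoundsMatrixTools

/-!
# `UlrichPadded.RankOneTrivialisation` (stmt-ValiantsHypothesis-5667): the adjugate of an affine
determinantal representation of `per_n` is an outer product modulo `per_n`, within degree budget `m − 1`

The crux of route `UlrichPadded` (rank 3):

  `∀ n ≥ 3, ∀ m (A : Matrix (Fin m) (Fin m) ℂ[x_{n×n}]), IsAffineDetRepr per_n A →
     ∃ c w dc dw, dc + dw ≤ m − 1 ∧ (∀ i, deg cᵢ ≤ dc) ∧ (∀ j, deg wⱼ ≤ dw) ∧
       ∀ i j, adj A i j − cᵢ wⱼ ∈ (per_n)`.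

## Proof (line `nagata-multilinear-chart` of the crux chain, gen-2 skeleton; every step a tree theorem)

Write `S_n = ℂ[x_{n×n}] ⧸ (per_n)` and `Ā` for `A` reduced modulo `per_n`.

1. **Factoriality** (closed crux 5666, `Summit.ValiantsHypothesis.Theorems.permQuot_isDomain_and_ufm`):
   for `n ≥ 3`, `S_n` is a domain and a UFD.  This is the only place `3 ≤ n` is used; at `n = 2`
   the crux is false (`RankOneTrivialisationNegative.rankOneTrivialisation_false_at_two`, the quadric
   cone is not factorial).
2. **Rank one** (`RankOneTrivialisation.stub_adjugate_twoByTwo_of_det_eq_zero`): `det Ā = per_n‾ = 0`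
   over the domain `S_n`, so all `2 × 2` minors of `adj Ā` vanish.
3. **Outer product over a UFD** (`RankOneTrivialisation.stub_ufdOuterProduct`, gcd extraction):
   `adj Ā = c̄ w̄ᵀ` for vectors `c̄, w̄` over `S_n`; lift them to polynomials `c₀, w₀`, so
   `adj A ≡ c₀ w₀ᵀ (mod per_n)` (`RingHom.map_adjugate`).
4. **Degree budget** (`RankOneTrivialisation.stub_degreeBudget_mod_homogeneous_prime`, with
   `f = per_n` homogeneous of degree `n` and prime, `D = m − 1`): the cofactors of an affine `m × m`
   matrix have total degree `≤ m − 1` (`KaltofenBounds.totalDegree_adjugate_le` — the only place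
   affineness is used; without it the crux is false, `…rankOneTrivialisation_false_nonaffine`), and
   modulo a homogeneous prime any outer-product factorisation of a matrix with entries of degree `≤ D`
   can be re-chosen with `dc + dw ≤ D`.  The budget `m − 1` is sharp (crux Disproof, twisted Grenet
   matrix `Bpp`).

Lead: `prover-line-stmt-ValiantsHypothesis-5667-0`; stub files
`UlrichPaddedRankOneTrivialisation{AdjugateTwoByTwo,UfdOuterProduct,DegreeBudget}.lean`; skeleton by
`planner-cruxplan-stmt-ValiantsHypothesis-5667-nagata-multilinear-c-g2-0`; degree engine after
`refuter-cdisprove-stmt-ValiantsHypothesis-5667` (Disproof.lean §DegreeBudget).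

## References

* [Vonzurgathen1987] J. von zur Gathen, *Permanent and determinant*, LAA 96 (1987) (irreducibility of
  `per_n`, Thm. 3.4; singular locus, Lemma 2.3).
* [Grothendieck1968SGA2] SGA 2 XI 3.14 and [Fossum1973] Cor. 10.3 (factoriality of `S_n`, via crux 5666).
* [KernerVinnikov2012], [Beauville2000] (kernel sheaves of determinantal hypersurfaces — the route's
  motivation; not used formally).
-/

noncomputable section

namespace Summit.ValiantsHypothesis.Theorems

open MvPolynomial Matrix Literature.Computability.AlgebraicComplexity
open Summit.ValiantsHypothesis.Theorems.RankOneTrivialisation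

/-- **Composition of the line `nagata-multilinear-chart`: rank one + outer product over a UFD +
degree budget ⇒ the crux (unfolded).**  Inputs, all PROVED in the tree: `S_n = ℂ[x]/(per_n)` is a
domain and a UFD for `n ≥ 3` (`permQuot_isDomain_and_ufm` — where `3 ≤ n` is consumed), `per_n` is
homogeneous (`perPoly_isHomogeneous`) and prime (`perPoly_irreducible`), the cofactors of an affine
`m × m` matrix have total degree `≤ m − 1` (`KaltofenBounds.totalDegree_adjugate_le` — where
affineness is consumed), and the three stub theorems of namespace `RankOneTrivialisation`.  Steps:
`det Ā = 0` (`RingHom.map_det`); the `2 × 2` minors of `adj Ā` vanish; `adj Ā = c̄ w̄ᵀ` over the UFD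
`S_n`; `adj Ā = (adj A)‾` (`RingHom.map_adjugate`); lift and normalise degrees with `D = m − 1`.
[folklore] -/
theorem rankOneTrivialisation_of_parts (n : ℕ) (hn : 3 ≤ n) (m : ℕ)
    (A : Matrix (Fin m) (Fin m) (MvPolynomial (Fin n × Fin n) ℂ))
    (hA : IsAffineDetRepr (perPoly (Fin n) ℂ) A) :
    ∃ (c w : Fin m → MvPolynomial (Fin n × Fin n) ℂ) (dc dw : ℕ), dc + dw ≤ m - 1 ∧
      (∀ i, (c i).totalDegree ≤ dc) ∧ (∀ i, (w i).totalDegree ≤ dw) ∧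
      ∀ i j, A.adjugate i j - c i * w j ∈ Ideal.span {perPoly (Fin n) ℂ} := by
  -- the permanental ring `S_n` is a domain and a UFD (closed crux 5666, UFD form, PROVED in the tree);
  -- this is the only place `3 ≤ n` is used
  set I : Ideal (MvPolynomial (Fin n × Fin n) ℂ) := Ideal.span {perPoly (Fin n) ℂ} with hI
  obtain ⟨hdom, hufm⟩ := Summit.ValiantsHypothesis.Theorems.permQuot_isDomain_and_ufm hn
  -- `per_n` is a homogeneous prime
  haveI : Nonempty (Fin n) := ⟨⟨0, by omega⟩⟩
  have hprime : Prime (perPoly (Fin n) ℂ) := (perPoly_irreducible (n := Fin n) (R := ℂ)).prime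
  have hhom : (perPoly (Fin n) ℂ).IsHomogeneous (Fintype.card (Fin n)) := perPoly_isHomogeneous
  -- `Ā = A mod per_n` is singular
  set Ab : Matrix (Fin m) (Fin m) (MvPolynomial (Fin n × Fin n) ℂ ⧸ I) :=
    (Ideal.Quotient.mk I).mapMatrix A with hAb
  have hdet : Ab.det = 0 := by
    rw [hAb, ← RingHom.map_det, hA.2]
    exact Ideal.Quotient.eq_zero_iff_mem.mpr (Ideal.subset_span rfl)
  -- stub 1: the `2 × 2` minors of `adj Ā` vanish
  have hmin : ∀ i j k l : Fin m,
      Ab.adjugate i j * Ab.adjugate k l = Ab.adjugate i l * Ab.adjugate k j :=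
    stub_adjugate_twoByTwo_of_det_eq_zero (MvPolynomial (Fin n × Fin n) ℂ ⧸ I) m Ab hdet
  -- stub 2: `adj Ā` is an outer product over the UFD `S_n`
  obtain ⟨c', w', hcw⟩ := stub_ufdOuterProduct (MvPolynomial (Fin n × Fin n) ℂ ⧸ I) m Ab.adjugate hmin
  -- lift the factors to polynomials
  choose c₀ hc₀ using fun i => Ideal.Quotient.mk_surjective (c' i)
  choose w₀ hw₀ using fun j => Ideal.Quotient.mk_surjective (w' j)
  have hadj : Ab.adjugate = (Ideal.Quotient.mk I).mapMatrix A.adjugate := by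
    rw [hAb, RingHom.map_adjugate]
  have hlift : ∀ i j, A.adjugate i j - c₀ i * w₀ j ∈ I := by
    intro i j
    refine Ideal.Quotient.eq.mp ?_
    rw [map_mul, hc₀ i, hw₀ j, ← hcw i j, hadj, RingHom.mapMatrix_apply, Matrix.map_apply]
  -- affineness: the cofactors of an affine `m × m` matrix have total degree `≤ m − 1` (tree, PROVED);
  -- this is the only place `hA.1` (entries of degree `≤ 1`) is used
  have hdeg : ∀ i j, (A.adjugate i j).totalDegree ≤ m - 1 := by
    intro i j
    have h := Literature.RingTheory.MvPolynomial.KaltofenBounds.totalDegree_adjugate_le A 1 hA.1 i j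
    rwa [Fintype.card_fin, mul_one] at h
  -- stub 3: normalise the degrees of the factors within the budget `D = m − 1`
  exact stub_degreeBudget_mod_homogeneous_prime (Fin n × Fin n) ℂ (perPoly (Fin n) ℂ)
    (Fintype.card (Fin n)) hhom hprime m (m - 1) A.adjugate hdeg c₀ w₀ hlift

/-- **Crux `UlrichPadded.RankOneTrivialisation` (stmt-ValiantsHypothesis-5667), proved:** for `n ≥ 3`
and every affine determinantal representation `A` of `per_n` of size `m` over `ℂ` there are polynomial
vectors `c, w` and degrees `dc + dw ≤ m − 1` (`deg cᵢ ≤ dc`, `deg wⱼ ≤ dw`) with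
`adj A ≡ c wᵀ (mod per_n)`.  Line `nagata-multilinear-chart`: UFD (`S_n`, crux 5666) ⇒ `adj Ā` rank one
⇒ outer product by gcd extraction ⇒ degree budget modulo the homogeneous prime `per_n`.
[cite: Vonzurgathen1987, Thm. 3.4] -/
theorem rankOneTrivialisation_proof :
    Summit.ValiantsHypothesis.ValiantsHypothesis.Theses.UlrichPadded.RankOneTrivialisation :=
  fun n hn m A hA => rankOneTrivialisation_of_parts n hn m A hA

end Summit.ValiantsHypothesis.Theorems

end
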